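import Summits.AtomisticToContinuum.BoseEinsteinCondensation.Theorems.BECInsertionCorrectorCorrectorClosureChemicalPotentialBorn
import HarnessLib

/-!
# The pinning energy of the static scatterer is at most the uniform Born term, uniformly in `N`
# (helper for stub A `stub_fidelityPair` of crux `BECProbeMassFlow.CloudMomentumAtom`)

Helper file for the crux `BECProbeMassFlow.CloudMomentumAtom` (item stmt-AtomisticToContinuum-12310),
line `registered` (skeleton `Cruxes/CloudMomentumAtom/Lines/birth.lean`, lead c3, skeleton v7). It supports
the infrared stub A (`stub_fidelityPair`, the ∃-pair Anderson fidelity of a pinned and a free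
near-minimiser) by recording, in the tree's variational vocabulary, the one N-UNIFORM energy fact every
attack on A starts from: the pinned-scatterer ground-state energy exceeds the free one by at most the
uniform Born (first-order, mean-field) term,

`E_imp(N, L, x) ≤ E^per(N, L) + N L⁻³ ∫_{[0,L)³} v^per = E^per(N, L) + (N/L³) ∫_{ℝ³} v(|y|) dy`,

and at the crux's side `L = sideLength ρ (N + 1)` (so that `N/L³ = ρ N/(N+1) ≤ ρ`)

`E_imp(N, sideLength ρ (N+1), 0) ≤ E^per(N, sideLength ρ (N+1)) + ρ ∫_{ℝ³} v(|y|) dy`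

for EVERY `N` — the "pinning costs at most `ρ ∫ v`" bound (finite exactly for integrable `v`; for hard
cores the right-hand side is `⊤` and the finiteness of `E_imp` is the landed `stub_impurityEnergyFinite`,
p147259). In the fidelity analysis of A this is the numerator `Δ_N ≤ ⟨χ_free, W χ_free⟩ ≤ ρ∫v = O(ρ b)`
of every gap / concavity estimate `1 − Z_N ≤ Δ_N/γ_N` (N-uniform, while the gap `γ_N ~ L⁻²` is not —
which is why A is infrared-bound: LEAD-REPORT-c3 §2).

Proof: the pinned ground-state energy does not depend on the pinning point
(`impurityPeriodicGroundStateEnergy_eq_of_position`, translation invariance of the torus), so for every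
periodic trial state `Φ`, averaging the variational principle `E_imp(x) ≤ ⟨Φ, (H + V_x) Φ⟩` over
`x ∈ [0,L)³` gives `L³ E_imp(0) ≤ ∫_{[0,L)³} ⟨Φ, (H + V_x) Φ⟩ dx = L³ ⟨Φ, HΦ⟩ + N ∫_{[0,L)³} v^per`
(`lintegral_cell_impurityPeriodicEnergy`, landed for the sibling route BECInsertionCorrector: Tonelli and
`∫_{[0,L)³} v^per(xⱼ - x) dx = ∫ v^per`); divide by `L³` and take the infimum over `Φ`.
-/

noncomputable section

namespace Summit.AtomisticToContinuum.BoseEinsteinCondensation.Cruxes.CloudMomentumAtom.Birth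

open MeasureTheory Filter
open scoped ENNReal NNReal BigOperators
open Literature.MathematicalPhysics.QuantumManyBody.BoseGas
open Summit.AtomisticToContinuum.BoseEinsteinCondensation.Theorems.CorrectorClosure.HealingScaleKacInsertion

variable {N : ℕ} {L : ℝ}

/-- **Averaged variational principle for the pinned scatterer.** For every periodic `N`-boson trial
state `Φ` on the torus of side `L > 0` and every pinning point `x`,
`E_imp(N, L, x) ≤ ⟨Φ, H(N,L) Φ⟩ + N (L³)⁻¹ ∫_{[0,L)³} v^per`: the pinned ground-state energy is the same
at every pinning point, and the cell average over the pinning point of `⟨Φ, (H + V_y) Φ⟩` is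
`⟨Φ, HΦ⟩ + N L⁻³ ∫ v^per`. [folklore] -/
theorem impurityPeriodicGroundStateEnergy_le_periodicEnergy_add_born {v : ℝ → ℝ≥0∞} (hv : Measurable v)
    (hL : 0 < L) (x : Space) (Φ : PeriodicTrialState N L) :
    impurityPeriodicGroundStateEnergy v N L x ≤
      periodicEnergy v Φ +
        (N : ℝ≥0∞) * (ENNReal.ofReal (L ^ 3))⁻¹ * ∫⁻ y in cell L, periodizedPotential v L y := by
  have h3 : ENNReal.ofReal L ^ 3 ≠ 0 := pow_ne_zero _ (ENNReal.ofReal_pos.2 hL).ne'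
  have h3' : ENNReal.ofReal L ^ 3 ≠ ⊤ := ENNReal.pow_ne_top ENNReal.ofReal_ne_top
  -- average the variational principle over the pinning point
  have havg : ENNReal.ofReal L ^ 3 * impurityPeriodicGroundStateEnergy v N L x ≤
      ENNReal.ofReal L ^ 3 * periodicEnergy v Φ +
        (N : ℝ≥0∞) * ∫⁻ y in cell L, periodizedPotential v L y := by
    calc ENNReal.ofReal L ^ 3 * impurityPeriodicGroundStateEnergy v N L x
        = ∫⁻ _y in cell L, impurityPeriodicGroundStateEnergy v N L x := by
          rw [setLIntegral_const, volume_cell, mul_comm]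
      _ = ∫⁻ y in cell L, impurityPeriodicGroundStateEnergy v N L y :=
          lintegral_congr fun y => impurityPeriodicGroundStateEnergy_eq_of_position v N L x y
      _ ≤ ∫⁻ y in cell L, impurityPeriodicEnergy v y Φ :=
          lintegral_mono fun y => impurityPeriodicGroundStateEnergy_le v y Φ
      _ = ENNReal.ofReal L ^ 3 * periodicEnergy v Φ +
            (N : ℝ≥0∞) * ∫⁻ y in cell L, periodizedPotential v L y :=
          lintegral_cell_impurityPeriodicEnergy hL hv Φ
  -- divide by `L³`
  have hkey : impurityPeriodicGroundStateEnergy v N L x ≤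
      periodicEnergy v Φ +
        (ENNReal.ofReal L ^ 3)⁻¹ * ((N : ℝ≥0∞) * ∫⁻ y in cell L, periodizedPotential v L y) := by
    calc impurityPeriodicGroundStateEnergy v N L x
        = (ENNReal.ofReal L ^ 3)⁻¹ *
            (ENNReal.ofReal L ^ 3 * impurityPeriodicGroundStateEnergy v N L x) := by
          rw [← mul_assoc, ENNReal.inv_mul_cancel h3 h3', one_mul]
      _ ≤ (ENNReal.ofReal L ^ 3)⁻¹ * (ENNReal.ofReal L ^ 3 * periodicEnergy v Φ +
            (N : ℝ≥0∞) * ∫⁻ y in cell L, periodizedPotential v L y) := by gcongr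
      _ = periodicEnergy v Φ +
            (ENNReal.ofReal L ^ 3)⁻¹ * ((N : ℝ≥0∞) * ∫⁻ y in cell L, periodizedPotential v L y) := by
          rw [mul_add, ← mul_assoc, ENNReal.inv_mul_cancel h3 h3', one_mul]
  calc impurityPeriodicGroundStateEnergy v N L x
      ≤ periodicEnergy v Φ +
          (ENNReal.ofReal L ^ 3)⁻¹ * ((N : ℝ≥0∞) * ∫⁻ y in cell L, periodizedPotential v L y) := hkey
    _ = periodicEnergy v Φ +
          (N : ℝ≥0∞) * (ENNReal.ofReal (L ^ 3))⁻¹ * ∫⁻ y in cell L, periodizedPotential v L y := by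
        rw [ENNReal.ofReal_pow hL.le, ← mul_assoc, mul_comm ((ENNReal.ofReal L ^ 3)⁻¹) (N : ℝ≥0∞)]

/-- **The pinning energy is at most the uniform Born term** (first-order / mean-field upper bound,
uniform in `N`): for a measurable pair profile `v ≥ 0` (hard cores allowed), `N` bosons on the torus of
side `L > 0` and any pinning point `x`,
`E_imp(N, L, x) ≤ E^per(N, L) + N (L³)⁻¹ ∫_{[0,L)³} v^per`. Companion of the chemical-potential bound
`periodicGroundStateEnergy_succ_le_add_born` (same Born term: a pinned scatterer is an added particle
of infinite mass). [folklore] -/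
theorem impurityPeriodicGroundStateEnergy_le_add_born {v : ℝ → ℝ≥0∞} (hv : Measurable v) (N : ℕ)
    (hL : 0 < L) (x : Space) :
    impurityPeriodicGroundStateEnergy v N L x ≤
      periodicGroundStateEnergy v N L +
        (N : ℝ≥0∞) * (ENNReal.ofReal (L ^ 3))⁻¹ * ∫⁻ y in cell L, periodizedPotential v L y := by
  rw [periodicGroundStateEnergy, ENNReal.iInf_add]
  exact le_iInf fun Φ => impurityPeriodicGroundStateEnergy_le_periodicEnergy_add_born hv hL x Φ

/-- The Born term unfolded: `N (L³)⁻¹ ∫_{[0,L)³} v^per = N (L³)⁻¹ ∫_{ℝ³} v(|y|) dy`. [folklore] -/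
theorem born_term_eq {v : ℝ → ℝ≥0∞} (hv : Measurable v) (N : ℕ) (hL : 0 < L) :
    (N : ℝ≥0∞) * (ENNReal.ofReal (L ^ 3))⁻¹ * ∫⁻ y in cell L, periodizedPotential v L y =
      (N : ℝ≥0∞) * (ENNReal.ofReal (L ^ 3))⁻¹ * ∫⁻ y : Space, v ‖y‖ := by
  have h := lintegral_cell_periodizedPotential_sub hL hv (0 : Space)
  simp only [sub_zero] at h
  rw [h]

/-- At the crux's side the Born prefactor is at most the density: `N · (L³)⁻¹ ≤ ρ` for
`L = sideLength ρ (N + 1)` (indeed `L³ = (N+1)/ρ`, so `N/L³ = ρ N/(N+1)`). [folklore] -/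
theorem natCast_mul_inv_ofReal_sideLength_pow_le {ρ : ℝ} (hρ : 0 < ρ) (N : ℕ) :
    (N : ℝ≥0∞) * (ENNReal.ofReal (sideLength ρ (N + 1) ^ 3))⁻¹ ≤ ENNReal.ofReal ρ := by
  have hL3 : sideLength ρ (N + 1) ^ 3 = ((N : ℝ) + 1) / ρ := by
    unfold sideLength
    rw [← Real.rpow_natCast, ← Real.rpow_mul (by positivity)]
    norm_num
  rw [hL3]
  have hpos : 0 < ((N : ℝ) + 1) / ρ := by positivity
  have hne : ENNReal.ofReal (((N : ℝ) + 1) / ρ) ≠ 0 := (ENNReal.ofReal_pos.2 hpos).ne'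
  have hne' : ENNReal.ofReal (((N : ℝ) + 1) / ρ) ≠ ⊤ := ENNReal.ofReal_ne_top
  -- `N ≤ ρ · ((N+1)/ρ) = N + 1`
  have hle : (N : ℝ≥0∞) ≤ ENNReal.ofReal ρ * ENNReal.ofReal (((N : ℝ) + 1) / ρ) := by
    rw [← ENNReal.ofReal_mul hρ.le, mul_div_cancel₀ _ hρ.ne']
    calc (N : ℝ≥0∞) = ENNReal.ofReal (N : ℝ) := (ENNReal.ofReal_natCast N).symm
      _ ≤ ENNReal.ofReal ((N : ℝ) + 1) := ENNReal.ofReal_le_ofReal (by linarith)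
  calc (N : ℝ≥0∞) * (ENNReal.ofReal (((N : ℝ) + 1) / ρ))⁻¹
      ≤ (ENNReal.ofReal ρ * ENNReal.ofReal (((N : ℝ) + 1) / ρ)) *
          (ENNReal.ofReal (((N : ℝ) + 1) / ρ))⁻¹ := by gcongr
    _ = ENNReal.ofReal ρ := by rw [mul_assoc, ENNReal.mul_inv_cancel hne hne', mul_one]

/-- **Pinning costs at most `ρ ∫ v`, uniformly in `N`** (the N-uniform first-order input of stub A
`stub_fidelityPair`): for a measurable pair profile `v ≥ 0`, every density `ρ > 0` and EVERY `N`, on the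
torus of side `L = sideLength ρ (N + 1)` (so `N/L³ ≤ ρ`),
`E_imp(N, L, 0) ≤ E^per(N, L) + ρ ∫_{ℝ³} v(|y|) dy`.
For integrable `v` the right-hand side is finite whenever `E^per` is; for hard cores it is `⊤` (then
finiteness of `E_imp` is the landed `stub_impurityEnergyFinite`). [folklore] -/
theorem stub_pinningBornBound :
    ∀ (v : ℝ → ℝ≥0∞), Measurable v → ∀ ρ : ℝ, 0 < ρ → ∀ N : ℕ,
      impurityPeriodicGroundStateEnergy v N (sideLength ρ (N + 1)) 0 ≤
        periodicGroundStateEnergy v N (sideLength ρ (N + 1)) +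
          ENNReal.ofReal ρ * ∫⁻ y : Space, v ‖y‖ := by
  intro v hv ρ hρ N
  have hL : 0 < sideLength ρ (N + 1) := by
    unfold sideLength
    exact Real.rpow_pos_of_pos (by positivity) _
  calc impurityPeriodicGroundStateEnergy v N (sideLength ρ (N + 1)) 0
      ≤ periodicGroundStateEnergy v N (sideLength ρ (N + 1)) +
          (N : ℝ≥0∞) * (ENNReal.ofReal (sideLength ρ (N + 1) ^ 3))⁻¹ *
            ∫⁻ y in cell (sideLength ρ (N + 1)), periodizedPotential v (sideLength ρ (N + 1)) y :=
        impurityPeriodicGroundStateEnergy_le_add_born hv N hL 0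
    _ = periodicGroundStateEnergy v N (sideLength ρ (N + 1)) +
          (N : ℝ≥0∞) * (ENNReal.ofReal (sideLength ρ (N + 1) ^ 3))⁻¹ * ∫⁻ y : Space, v ‖y‖ := by
        rw [born_term_eq hv N hL]
    _ ≤ periodicGroundStateEnergy v N (sideLength ρ (N + 1)) +
          ENNReal.ofReal ρ * ∫⁻ y : Space, v ‖y‖ := by
        gcongr
        exact natCast_mul_inv_ofReal_sideLength_pow_le hρ N

/-- **Every free near-minimiser is a pinned near-minimiser up to the Born term** (the trial-state form
used by stub A): if `⟨Ψ, HΨ⟩ ≤ E^per + δ` then `E_imp(N, L, x) ≤ ⟨Ψ, HΨ⟩ + N L⁻³∫v^per ≤ E^per + δ + N L⁻³ ∫ v^per`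
and, the scatterer being non-negative, `⟨Ψ, (H + V_x)Ψ⟩ ≥ ⟨Ψ, HΨ⟩ ≥ E^per`; here the first half,
at any side `L > 0`. [folklore] -/
theorem impurityPeriodicGroundStateEnergy_le_of_near_minimiser {v : ℝ → ℝ≥0∞} (hv : Measurable v)
    (hL : 0 < L) (x : Space) {δ : ℝ≥0∞} (Ψ : PeriodicTrialState N L)
    (hΨ : periodicEnergy v Ψ ≤ periodicGroundStateEnergy v N L + δ) :
    impurityPeriodicGroundStateEnergy v N L x ≤
      periodicGroundStateEnergy v N L + δ +
        (N : ℝ≥0∞) * (ENNReal.ofReal (L ^ 3))⁻¹ * ∫⁻ y in cell L, periodizedPotential v L y :=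
  (impurityPeriodicGroundStateEnergy_le_periodicEnergy_add_born hv hL x Ψ).trans (by gcongr)

/-! ### No pile-up at the scatterer (appended by lead c3, same session) -/

/-- **Pinned near-minimisers feel the scatterer at most at the Born scale, uniformly in `N`**
(registered sub-goal; the lower endpoint of the concavity sandwich
`0 ≤ ⟨Φ, V₀ Φ⟩ ≤ E_imp + δ − E^per ≤ ρ∫v + δ`): for a measurable pair profile `v ≥ 0`, every density
`ρ > 0`, EVERY `N`, every slack `δ` and every periodic trial state `Φ` on the torus of side
`L = sideLength ρ (N + 1)` with `⟨Φ, (H + V₀) Φ⟩ ≤ E_imp(N, L, 0) + δ` and `E^per(N, L) < ⊤`, the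
scatterer term obeys `∫_{cell^N} (∑ⱼ v^per(xⱼ)) |Φ|² ≤ ρ ∫_{ℝ³} v + δ` — a repulsive pinned scatterer never
raises the `v`-weighted local density of a near-minimiser above the uniform Born value (first-order
depletion, no enhancement). Proof: `E^per + ∫V₀|Φ|² ≤ ⟨Φ, HΦ⟩ + ∫V₀|Φ|² = ⟨Φ, (H+V₀)Φ⟩ ≤ E_imp + δ ≤ E^per + ρ∫v + δ`
(`stub_pinningBornBound`) and `E^per` cancels. [folklore] -/
theorem stub_scattererTermBornBound :
    ∀ (v : ℝ → ℝ≥0∞), Measurable v → ∀ ρ : ℝ, 0 < ρ → ∀ (N : ℕ) (δ : ℝ≥0∞)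
      (Φ : PeriodicTrialState N (sideLength ρ (N + 1))),
      periodicGroundStateEnergy v N (sideLength ρ (N + 1)) ≠ ⊤ →
      impurityPeriodicEnergy v 0 Φ ≤ impurityPeriodicGroundStateEnergy v N (sideLength ρ (N + 1)) 0 + δ →
        ∫⁻ X in cellN N (sideLength ρ (N + 1)),
            (∑ j : Fin N, periodizedPotential v (sideLength ρ (N + 1)) (X j - 0)) *
              (‖Φ.ψ X‖₊ : ℝ≥0∞) ^ 2 ≤
          ENNReal.ofReal ρ * (∫⁻ y : Space, v ‖y‖) + δ := by
  intro v hv ρ hρ N δ Φ hE hΦ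
  have hsand : periodicGroundStateEnergy v N (sideLength ρ (N + 1)) +
      ∫⁻ X in cellN N (sideLength ρ (N + 1)),
        (∑ j : Fin N, periodizedPotential v (sideLength ρ (N + 1)) (X j - 0)) *
          (‖Φ.ψ X‖₊ : ℝ≥0∞) ^ 2 ≤
      periodicGroundStateEnergy v N (sideLength ρ (N + 1)) +
        (ENNReal.ofReal ρ * (∫⁻ y : Space, v ‖y‖) + δ) :=
    calc periodicGroundStateEnergy v N (sideLength ρ (N + 1)) +
          ∫⁻ X in cellN N (sideLength ρ (N + 1)),
            (∑ j : Fin N, periodizedPotential v (sideLength ρ (N + 1)) (X j - 0)) *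
              (‖Φ.ψ X‖₊ : ℝ≥0∞) ^ 2
        ≤ periodicEnergy v Φ +
          ∫⁻ X in cellN N (sideLength ρ (N + 1)),
            (∑ j : Fin N, periodizedPotential v (sideLength ρ (N + 1)) (X j - 0)) *
              (‖Φ.ψ X‖₊ : ℝ≥0∞) ^ 2 := by
          gcongr
          exact periodicGroundStateEnergy_le v Φ
      _ = impurityPeriodicEnergy v 0 Φ := (impurityPeriodicEnergy_def v 0 Φ).symm
      _ ≤ impurityPeriodicGroundStateEnergy v N (sideLength ρ (N + 1)) 0 + δ := hΦ
      _ ≤ periodicGroundStateEnergy v N (sideLength ρ (N + 1)) +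
            ENNReal.ofReal ρ * (∫⁻ y : Space, v ‖y‖) + δ := by
          gcongr
          exact stub_pinningBornBound v hv ρ hρ N
      _ = periodicGroundStateEnergy v N (sideLength ρ (N + 1)) +
            (ENNReal.ofReal ρ * (∫⁻ y : Space, v ‖y‖) + δ) := add_assoc _ _ _
  exact (ENNReal.add_le_add_iff_left hE).1 hsand

end Summit.AtomisticToContinuum.BoseEinsteinCondensation.Cruxes.CloudMomentumAtom.Birth

end
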